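import Mathlib
import Literature.Analysis.FluidPDE.VectorCalculus
import Literature.Analysis.FluidPDE.SelfSimilarEulerProfile
import Literature.Analysis.FluidPDE.SelfSimilarEulerProfileVorticity
import Literature.Analysis.FluidPDE.SelfSimilarEulerVorticityLqBalance
import Summits.NavierStokesRegularity.NavierStokesRegularity.Theorems.EulerZoomLiouvillePowerGaugeEulerLiouvilleSmallMomentTools

/-!
# nsreg-p2 ROUND-53 «THE FLOOR» — t57-GLUE: the R53 faces (defs) and the class-free glue, VERBATIM from `r53/Sketch53.lean` v1.0
# (sha16 8300150c723efd46, §A–§C; texts and proofs by the planner nsreg-p2 g43; landed by the width seat ns-ezl-w2 g6, `E3` spelled out)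

Crux `EulerZoomLiouville.PowerGaugeEulerLiouville` (stmt-NavierStokesRegularity-19832).  Setting: a `C²` self-similar Euler profile `(V, P)`
with exponent `γ = 1/(2+ρ)` (Literature `IsSelfSimilarEulerProfile γ 0 V P`), the E-gauge weighted energy `∫ ‖DV‖²‖y‖^{ρ−1} < ∞`, the A-gauge
`∫_{B_R}‖V‖² ≤ A R^{1−2ρ}`, `Ω = curl V`.  §A: the faces `SmallMomentLaw` (R52), `TwoSidedMomentLaw` (F1), `SharpMomentLimitLaw` (F2), `MomentFloorLaw`
(F3, THE FLOOR), `SupportDensityFloor` (F3a), `BorderlineVorticityDensity` (F4), `LqVorticityExclusion` (F5), `HasLqVorticity`, `HasSubBorderlineVorticity`.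
§B/§C: the class-free glue PROVED — `lqVorticityExclusion_of_momentFloorLaw` (F3 ⇒ F5, Cauchy–Schwarz on balls), `curl_eq_zero_of_hasLqVorticity_of_momentFloorLaw`,
`borderlineVorticityDensity_of_floor_of_smallMoment` (F3 + SmallMomentLaw ⇒ F4, Paley–Zygmund), `curl_eq_zero_of_subBorderline_of_momentFloorLaw`.

HONEST FRAMING: faces + glue about HYPOTHETICAL profiles (MODEL-lattice instrument); (F1)/(F3)/(F3a) are NOT proved here; nothing about the crux E
(19832 OPEN) or NS regularity is proved; not E. [nsreg-p2 R53; cite: ChaeShvydkoy2013 §4 Thm 4.1, eq. (4.2); ChaeTsai2014 (MRL 21) Thm 2.1]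
-/

noncomputable section

set_option linter.dupNamespace false

namespace Summit.NavierStokesRegularity.NavierStokesRegularity.Theorems.PowerGaugeEulerLiouville.MomentFloor

open MeasureTheory Set Filter Topology Metric Function Literature.Analysis.FluidPDE InnerProductSpace
open scoped RealInnerProductSpace ENNReal

/-! ## §A  The faces (statements for R53; provability labels in ROUND-53.md §2) -/

/-- **R52's SMALL-MOMENT LAW** (copied VERBATIM from `r52/Sketch52E.lean` l.76, `NsregP2.R52.Provenance.SmallMomentLaw`; being landed by
ns-sfl-p1 g9 as `SmallMoment.smallMomentLaw`, t56-SM DELIVERABLE 2): the UPPER law `∫_{B_R}‖Ω‖^{2p} ≤ C·R^{3−2p(2+ρ)}`, `0 < p < ½`. -/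
def SmallMomentLaw (ρ : ℝ) (V : (EuclideanSpace ℝ (Fin 3)) → (EuclideanSpace ℝ (Fin 3))) : Prop :=
  ∀ P : (EuclideanSpace ℝ (Fin 3)) → ℝ, IsSelfSimilarEulerProfile (1 / (2 + ρ)) 0 V P →
    ∀ p : ℝ, 0 < p → p < 1 / 2 →
    (∫⁻ y, ‖fderiv ℝ V y‖ₑ ^ 2 * ENNReal.ofReal (‖y‖ ^ (ρ - 1))) ≠ ⊤ →
    (∃ A : ℝ, ∀ R : ℝ, 1 ≤ R → ∫ y in Metric.ball (0 : (EuclideanSpace ℝ (Fin 3))) R, ‖V y‖ ^ 2 ≤ A * R ^ (1 - 2 * ρ)) →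
      ∃ C : ℝ, ∀ R : ℝ, 1 ≤ R →
        ∫ y in Metric.ball (0 : (EuclideanSpace ℝ (Fin 3))) R, ‖curl V y‖ ^ (2 * p) ≤ C * R ^ (3 - 2 * p * (2 + ρ))

/-- **(F1) THE TWO-SIDED MOMENT LAW, uniform in the exponent** (weighted by ANY compactly supported `C¹` weight `g` dilated to scale `R` —
a `ContDiffBump`, or sfl-p1's `ψ_s = σ(2 − ‖y‖²/s²) = g(s⁻¹y)` with `g z = σ(2 − ‖z‖²)`; with rate; provable-L from `vorticity_rpow_balance` (χ = g(R⁻¹·),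
any `C¹` compactly supported χ) + the two budgets): for every such `g` and every `q₀ < 1` there is ONE constant `C` such that for all `q ∈ (0, q₀]` the
normalised moment `m_g(R) = R^{q(2+ρ)−3}·∫ g(R⁻¹y)‖Ω(y)‖^q dy` has a LIMIT `L = L(q,g)` with `|m_g(R) − L| ≤ C·R^{−(1−q₀)(1+ρ/2)}` for `R ≥ 1`
(`γR·M_g′ = (3γ−q)M_g + q·Str_g + Sph_g` EXACTLY, `Str_g = ∫ g(R⁻¹y)‖Ω‖^{q−2}⟪DVΩ,Ω⟫`, `Sph_g = R⁻¹∫‖Ω‖^q·Dg(R⁻¹y)[V y]`, so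
`m_g′ = (q·Str_g + Sph_g)/(γR^{4−q(2+ρ)}) = O(R^{−2−ρ/2+q₀(1+ρ/2)})` uniformly in `q ≤ q₀` for `R ≥ 1` — INTEGRABLE; no sign of `g` is used).  The
uniformity as `q ↓ 0` is what THE FLOOR's positivity step consumes. -/
def TwoSidedMomentLaw (ρ : ℝ) (V : (EuclideanSpace ℝ (Fin 3)) → (EuclideanSpace ℝ (Fin 3))) : Prop :=
  ∀ P : (EuclideanSpace ℝ (Fin 3)) → ℝ, IsSelfSimilarEulerProfile (1 / (2 + ρ)) 0 V P →
    (∫⁻ y, ‖fderiv ℝ V y‖ₑ ^ 2 * ENNReal.ofReal (‖y‖ ^ (ρ - 1))) ≠ ⊤ →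
    (∃ A : ℝ, ∀ R : ℝ, 1 ≤ R → ∫ y in Metric.ball (0 : (EuclideanSpace ℝ (Fin 3))) R, ‖V y‖ ^ 2 ≤ A * R ^ (1 - 2 * ρ)) →
      ∀ g : (EuclideanSpace ℝ (Fin 3)) → ℝ, ContDiff ℝ 1 g → HasCompactSupport g → ∀ q₀ : ℝ, 0 < q₀ → q₀ < 1 → ∃ C : ℝ, ∀ q : ℝ, 0 < q → q ≤ q₀ →
        ∃ L : ℝ, ∀ R : ℝ, 1 ≤ R →
          |R ^ (q * (2 + ρ) - 3) * (∫ y, g (R⁻¹ • y) * ‖curl V y‖ ^ q) - L| ≤ C * R ^ (-((1 - q₀) * (1 + ρ / 2)))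

/-- **(F2) THE SHARP-BALL LIMIT LAW** (provable-M from (F1) by the sandwich `∫_{B_{rIn·R}} ≤ ∫ f(R⁻¹·)… ≤ ∫_{B_{rOut·R}}` with `rOut/rIn ↓ 1`):
`R^{q(2+ρ)−3}·∫_{B_R}‖Ω‖^q → L_q` as `R → ∞`, every `q ∈ (0,1)`. -/
def SharpMomentLimitLaw (ρ : ℝ) (V : (EuclideanSpace ℝ (Fin 3)) → (EuclideanSpace ℝ (Fin 3))) : Prop :=
  ∀ P : (EuclideanSpace ℝ (Fin 3)) → ℝ, IsSelfSimilarEulerProfile (1 / (2 + ρ)) 0 V P →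
    ∀ q : ℝ, 0 < q → q < 1 →
    (∫⁻ y, ‖fderiv ℝ V y‖ₑ ^ 2 * ENNReal.ofReal (‖y‖ ^ (ρ - 1))) ≠ ⊤ →
    (∃ A : ℝ, ∀ R : ℝ, 1 ≤ R → ∫ y in Metric.ball (0 : (EuclideanSpace ℝ (Fin 3))) R, ‖V y‖ ^ 2 ≤ A * R ^ (1 - 2 * ρ)) →
      ∃ L : ℝ, Tendsto (fun R : ℝ => R ^ (q * (2 + ρ) - 3) * ∫ y in Metric.ball (0 : (EuclideanSpace ℝ (Fin 3))) R, ‖curl V y‖ ^ q) atTop (𝓝 L)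

/-- **(F3) THE FLOOR** (the headline; provable-L = (F1) + the tree's `q = 0` support-density law + reverse Hölder in `q`): a budget-class profile
whose vorticity does not vanish identically has, for EVERY `q ∈ (0,1)`, `∫_{B_R}‖Ω‖^q ≥ ℓ·R^{3−q(2+ρ)}` (`ℓ > 0`) for all large `R` —
vorticity does NOT decay faster than the self-similar borderline `R^{−(2+ρ)}` in any `L^q`-mean. -/
def MomentFloorLaw (ρ : ℝ) (V : (EuclideanSpace ℝ (Fin 3)) → (EuclideanSpace ℝ (Fin 3))) : Prop :=
  ∀ P : (EuclideanSpace ℝ (Fin 3)) → ℝ, IsSelfSimilarEulerProfile (1 / (2 + ρ)) 0 V P →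
    (∫⁻ y, ‖fderiv ℝ V y‖ₑ ^ 2 * ENNReal.ofReal (‖y‖ ^ (ρ - 1))) ≠ ⊤ →
    (∃ A : ℝ, ∀ R : ℝ, 1 ≤ R → ∫ y in Metric.ball (0 : (EuclideanSpace ℝ (Fin 3))) R, ‖V y‖ ^ 2 ≤ A * R ^ (1 - 2 * ρ)) →
    (∃ y, curl V y ≠ 0) →
      ∀ q : ℝ, 0 < q → q < 1 → ∃ ℓ R₁ : ℝ, 0 < ℓ ∧ ∀ R : ℝ, R₁ ≤ R →
        ℓ * R ^ (3 - q * (2 + ρ)) ≤ ∫ y in Metric.ball (0 : (EuclideanSpace ℝ (Fin 3))) R, ‖curl V y‖ ^ q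

/-- **(F3a) THE SUPPORT-DENSITY FLOOR** (the `q = 0` end of THE FLOOR; provable-M from the tree's weak_eulerian tools BY NAME —
`NeedleDigest.renormalisedVorticity_classical` ⇒ `WeakEulerian.supportLaw_of_renormalised` (the support law for `S = {Ω ≠ 0}`), then
`WeakEulerian.massF_div_cube_sub` + `abs_errE_le` (the normalised bump mass of `S` is CAUCHY with rate `R^{−2−ρ}`, hence converges to some `q_∞`),
and `q_∞ = 0` ⇒ density `→ 0` ⇒ `vol S = 0` (`measure_eq_zero_of_supportLaw_of_density`) ⇒ `Ω ≡ 0` by continuity — so `Ω ≢ 0` forces `q_∞ > 0`):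
a non-trivial budget profile has vortical support of POSITIVE LOWER DENSITY, `vol({Ω ≠ 0} ∩ B_R) ≥ c₀R³` for all large `R` — the liminf
sharpening of the LEAD's `NeedleDigest.vorticity_support_upper_density` (`¬ density → 0`). -/
def SupportDensityFloor (ρ : ℝ) (V : (EuclideanSpace ℝ (Fin 3)) → (EuclideanSpace ℝ (Fin 3))) : Prop :=
  ∀ P : (EuclideanSpace ℝ (Fin 3)) → ℝ, IsSelfSimilarEulerProfile (1 / (2 + ρ)) 0 V P →
    (∫⁻ y, ‖fderiv ℝ V y‖ₑ ^ 2 * ENNReal.ofReal (‖y‖ ^ (ρ - 1))) ≠ ⊤ →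
    (∃ A : ℝ, ∀ R : ℝ, 1 ≤ R → ∫ y in Metric.ball (0 : (EuclideanSpace ℝ (Fin 3))) R, ‖V y‖ ^ 2 ≤ A * R ^ (1 - 2 * ρ)) →
      (∃ y, curl V y ≠ 0) → ∃ c₀ R₀ : ℝ, 0 < c₀ ∧ ∀ R : ℝ, R₀ ≤ R →
        c₀ * R ^ (3 : ℝ) ≤ (volume ({y : (EuclideanSpace ℝ (Fin 3)) | curl V y ≠ 0} ∩ Metric.ball (0 : (EuclideanSpace ℝ (Fin 3))) R)).toReal

/-- **(F4) POSITIVE-DENSITY BORDERLINE VORTICITY** (provable-M = (F3) at `q` + `SmallMomentLaw` at `q′ = 2p ∈ (q,1)` + Paley–Zygmund /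
Hölder on `B_R`): there are `λ, c > 0` with `vol{y ∈ B_R : ‖Ω(y)‖ ≥ λ·R^{−(2+ρ)}} ≥ c·R³` for all large `R`. -/
def BorderlineVorticityDensity (ρ : ℝ) (V : (EuclideanSpace ℝ (Fin 3)) → (EuclideanSpace ℝ (Fin 3))) : Prop :=
  ∀ P : (EuclideanSpace ℝ (Fin 3)) → ℝ, IsSelfSimilarEulerProfile (1 / (2 + ρ)) 0 V P →
    (∫⁻ y, ‖fderiv ℝ V y‖ₑ ^ 2 * ENNReal.ofReal (‖y‖ ^ (ρ - 1))) ≠ ⊤ →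
    (∃ A : ℝ, ∀ R : ℝ, 1 ≤ R → ∫ y in Metric.ball (0 : (EuclideanSpace ℝ (Fin 3))) R, ‖V y‖ ^ 2 ≤ A * R ^ (1 - 2 * ρ)) →
    (∃ y, curl V y ≠ 0) →
      ∃ lam c R₁ : ℝ, 0 < lam ∧ 0 < c ∧ ∀ R : ℝ, R₁ ≤ R →
        c * R ^ (3 : ℝ) ≤ (volume {y ∈ Metric.ball (0 : (EuclideanSpace ℝ (Fin 3))) R | lam * R ^ (-(2 + ρ)) ≤ ‖curl V y‖}).toReal

/-- **(F5) THE `L^q`-VORTICITY EXCLUSION in the budget class** (Chae–Shvydkoy 2013 Thm 4.1 with «strain → 0 at infinity» REPLACED by the two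
gauge budgets; the critical exponent `3/(2+ρ) = 3γ` is theirs): `∫ ‖Ω‖^q < ∞` for ONE `q ∈ (0, 3/(2+ρ))` forces `Ω ≡ 0` (then `V ≡ 0` by the
tree's irrotational closer `profile_eq_zero_of_irrotationalC2`).  PROVED below from (F3). -/
def LqVorticityExclusion (ρ : ℝ) (V : (EuclideanSpace ℝ (Fin 3)) → (EuclideanSpace ℝ (Fin 3))) : Prop :=
  ∀ P : (EuclideanSpace ℝ (Fin 3)) → ℝ, IsSelfSimilarEulerProfile (1 / (2 + ρ)) 0 V P →
    (∫⁻ y, ‖fderiv ℝ V y‖ₑ ^ 2 * ENNReal.ofReal (‖y‖ ^ (ρ - 1))) ≠ ⊤ →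
    (∃ A : ℝ, ∀ R : ℝ, 1 ≤ R → ∫ y in Metric.ball (0 : (EuclideanSpace ℝ (Fin 3))) R, ‖V y‖ ^ 2 ≤ A * R ^ (1 - 2 * ρ)) →
      ∀ q : ℝ, 0 < q → q * (2 + ρ) < 3 → Integrable (fun y => ‖curl V y‖ ^ q) → ∀ y, curl V y = 0

/-- **FACE «L^q VORTICITY»** (alternative candidate for the LEAD's disjunction, profile level, NO tameness / decay of `DV`): the profile
vorticity has one finite moment of sub-critical order, `∫ ‖curl V‖^q < ∞`, `0 < q < 3/(2+ρ)`. (F5) says the budget class excludes it.) -/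
def HasLqVorticity (ρ : ℝ) (V : (EuclideanSpace ℝ (Fin 3)) → (EuclideanSpace ℝ (Fin 3))) : Prop :=
  ∃ q : ℝ, 0 < q ∧ q * (2 + ρ) < 3 ∧ Integrable (fun y => ‖curl V y‖ ^ q)

/-- **FACE «SUB-BORDERLINE VORTICITY IN q-MEAN»** (the most general R53 alternative for the LEAD's disjunction; the vorticity analogue of the tree's
sub-extremal ENERGY face `ae_eq_zero_of_subExtremal`): for some `q ∈ (0,1)` the `q`-moment of the vorticity on large balls dips below every multiple of the
borderline `R^{3−q(2+ρ)}` along a sequence `R → ∞`.  THE FLOOR is exactly its denial for non-trivial profiles (`curl_eq_zero_of_subBorderline_of_momentFloorLaw`). -/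
def HasSubBorderlineVorticity (ρ : ℝ) (V : (EuclideanSpace ℝ (Fin 3)) → (EuclideanSpace ℝ (Fin 3))) : Prop :=
  ∃ q : ℝ, 0 < q ∧ q < 1 ∧ ∀ ε : ℝ, 0 < ε → ∀ R₀ : ℝ, ∃ R : ℝ, R₀ ≤ R ∧
    ∫ y in Metric.ball (0 : (EuclideanSpace ℝ (Fin 3))) R, ‖curl V y‖ ^ q ≤ ε * R ^ (3 - q * (2 + ρ))

/-! ## §B  Proved glue: THE FLOOR closes the `L^q`-vorticity face (class-free real analysis) -/

/-- `vol(B(0,R)) = R³ · vol(B(0,1))` in `ℝ³` (Haar scaling), real form. [folklore] -/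
theorem volume_ball_toReal_eq (R : ℝ) (hR : 0 ≤ R) :
    (volume (Metric.ball (0 : (EuclideanSpace ℝ (Fin 3))) R)).toReal = R ^ (3 : ℕ) * (volume (Metric.ball (0 : (EuclideanSpace ℝ (Fin 3))) 1)).toReal := by
  rw [Measure.addHaar_ball volume (0 : (EuclideanSpace ℝ (Fin 3))) hR, finrank_euclideanSpace_fin, ENNReal.toReal_mul,
    ENNReal.toReal_ofReal (pow_nonneg hR 3)]

/-- **Cauchy–Schwarz on a set of finite measure for the half moment**: `∫_s ‖Ω‖^{q/2} ≤ vol(s)^{1/2} · (∫_s ‖Ω‖^q)^{1/2}` for continuous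
`Ω` with `‖Ω‖^q` integrable on `s` (the tree's `SmallMoment.setIntegral_rpow_le_of_sq` with exponent `1` applied to `‖Ω‖^{q/2}`). [folklore] -/
theorem setIntegral_rpow_half_le {Ω : (EuclideanSpace ℝ (Fin 3)) → (EuclideanSpace ℝ (Fin 3))} (hΩ : Continuous Ω) {q : ℝ} (_hq : 0 < q) {s : Set (EuclideanSpace ℝ (Fin 3))} (hs : volume s ≠ ⊤)
    (hint : IntegrableOn (fun y => ‖Ω y‖ ^ q) s) :
    ∫ y in s, ‖Ω y‖ ^ (q / 2) ≤ (volume s).toReal ^ (1 / 2 : ℝ) * (∫ y in s, ‖Ω y‖ ^ q) ^ (1 / 2 : ℝ) := by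
  have hsq : ∀ y, (‖Ω y‖ ^ (q / 2)) ^ 2 = ‖Ω y‖ ^ q := fun y => by
    rw [← Real.rpow_natCast, ← Real.rpow_mul (norm_nonneg _)]
    congr 1; push_cast; ring_nf
  have hf2 : IntegrableOn (fun y => (‖Ω y‖ ^ (q / 2)) ^ 2) s := by
    simp_rw [hsq]; exact hint
  have hm : Measurable fun y => ‖Ω y‖ ^ (q / 2) := (hΩ.measurable.norm).pow_const _
  have h := Summit.NavierStokesRegularity.NavierStokesRegularity.Theorems.PowerGaugeEulerLiouville.SmallMoment.setIntegral_rpow_le_of_sq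
    (f := fun y => ‖Ω y‖ ^ (q / 2)) (s := s) hs
    (fun y => Real.rpow_nonneg (norm_nonneg _) _) hm hf2 one_pos (by norm_num : (1 : ℝ) ≤ 2)
  simp_rw [Real.rpow_one, hsq] at h
  convert h using 2; norm_num

/-- **THE FLOOR CLOSES THE `L^q`-VORTICITY FACE** (`0 ≤ ρ`): `MomentFloorLaw ρ V → LqVorticityExclusion ρ V`.  Proof: if `Ω ≢ 0`, apply the
floor at the exponent `q/2 ∈ (0,1)` (`q < 3/(2+ρ) ≤ 3/2`) and Cauchy–Schwarz on `B_R`: `ℓ·R^{3−(q/2)(2+ρ)} ≤ vol(B_R)^{1/2}·(∫‖Ω‖^q)^{1/2}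
= R^{3/2}·K`, i.e. `ℓ·R^{e} ≤ K` with `e = 3/2 − q(2+ρ)/2 > 0` — absurd as `R → ∞`. [nsreg-p2 R53 §2] -/
theorem lqVorticityExclusion_of_momentFloorLaw {ρ : ℝ} (hρ : 0 ≤ ρ) {V : (EuclideanSpace ℝ (Fin 3)) → (EuclideanSpace ℝ (Fin 3))} (hfloor : MomentFloorLaw ρ V) :
    LqVorticityExclusion ρ V := by
  intro P hprof hE hA q hq hq3 hint
  by_contra hne
  push Not at hne
  -- the curl is continuous
  have hV2 : ContDiff ℝ 2 V := hprof.contDiff_velocity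
  have hΩc : Continuous (curl V) := (contDiff_curl (n := 1) (by exact_mod_cast hV2)).continuous
  -- the floor at `q/2`
  have hq2 : 0 < q / 2 := by positivity
  have hq32 : q < 3 / 2 := by
    by_contra h
    push Not at h
    have : 3 ≤ q * (2 + ρ) := by nlinarith
    linarith
  have hq2' : q / 2 < 1 := by linarith
  obtain ⟨ℓ, R₁, hℓ, hfl⟩ := hfloor P hprof hE hA hne (q / 2) hq2 hq2'
  -- constants
  set I : ℝ := ∫ y, ‖curl V y‖ ^ q with hI
  have hI0 : 0 ≤ I := integral_nonneg fun y => Real.rpow_nonneg (norm_nonneg _) _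
  set v₁ : ℝ := (volume (Metric.ball (0 : (EuclideanSpace ℝ (Fin 3))) 1)).toReal with hv₁
  have hv₁0 : 0 ≤ v₁ := ENNReal.toReal_nonneg
  set K : ℝ := v₁ ^ (1 / 2 : ℝ) * I ^ (1 / 2 : ℝ) with hK
  have hK0 : 0 ≤ K := mul_nonneg (Real.rpow_nonneg hv₁0 _) (Real.rpow_nonneg hI0 _)
  set e : ℝ := 3 / 2 - q / 2 * (2 + ρ) with he
  have he0 : 0 < e := by rw [he]; nlinarith
  -- (1) eventually `ℓ R^e ≤ K`
  have h1 : ∀ᶠ R : ℝ in atTop, ℓ * R ^ e ≤ K := by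
    filter_upwards [eventually_ge_atTop R₁, eventually_ge_atTop (1 : ℝ)] with R hR hR1
    have hR0 : 0 < R := by linarith
    have hfloorR := hfl R hR
    -- Cauchy–Schwarz and the global moment
    have hintR : IntegrableOn (fun y => ‖curl V y‖ ^ q) (Metric.ball (0 : (EuclideanSpace ℝ (Fin 3))) R) := hint.integrableOn
    have hCS := setIntegral_rpow_half_le hΩc hq measure_ball_lt_top.ne hintR
    have hJI : ∫ y in Metric.ball (0 : (EuclideanSpace ℝ (Fin 3))) R, ‖curl V y‖ ^ q ≤ I :=
      setIntegral_le_integral hint (ae_of_all _ fun y => Real.rpow_nonneg (norm_nonneg _) _)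
    have hJ0 : 0 ≤ ∫ y in Metric.ball (0 : (EuclideanSpace ℝ (Fin 3))) R, ‖curl V y‖ ^ q :=
      integral_nonneg fun y => Real.rpow_nonneg (norm_nonneg _) _
    have hvol : (volume (Metric.ball (0 : (EuclideanSpace ℝ (Fin 3))) R)).toReal = R ^ (3 : ℕ) * v₁ := volume_ball_toReal_eq R hR0.le
    have hvolrt : (volume (Metric.ball (0 : (EuclideanSpace ℝ (Fin 3))) R)).toReal ^ (1 / 2 : ℝ) = R ^ (3 / 2 : ℝ) * v₁ ^ (1 / 2 : ℝ) := by
      rw [hvol, Real.mul_rpow (pow_nonneg hR0.le 3) hv₁0, ← Real.rpow_natCast, ← Real.rpow_mul hR0.le]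
      norm_num
    have hub : ∫ y in Metric.ball (0 : (EuclideanSpace ℝ (Fin 3))) R, ‖curl V y‖ ^ (q / 2) ≤ R ^ (3 / 2 : ℝ) * K := by
      calc ∫ y in Metric.ball (0 : (EuclideanSpace ℝ (Fin 3))) R, ‖curl V y‖ ^ (q / 2)
          ≤ (volume (Metric.ball (0 : (EuclideanSpace ℝ (Fin 3))) R)).toReal ^ (1 / 2 : ℝ) *
              (∫ y in Metric.ball (0 : (EuclideanSpace ℝ (Fin 3))) R, ‖curl V y‖ ^ q) ^ (1 / 2 : ℝ) := hCS
        _ ≤ (volume (Metric.ball (0 : (EuclideanSpace ℝ (Fin 3))) R)).toReal ^ (1 / 2 : ℝ) * I ^ (1 / 2 : ℝ) := by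
              gcongr
        _ = R ^ (3 / 2 : ℝ) * K := by rw [hvolrt, hK]; ring
    -- combine with the floor: ℓ R^{3 − (q/2)(2+ρ)} ≤ R^{3/2} K
    have hcomb : ℓ * R ^ (3 - q / 2 * (2 + ρ)) ≤ R ^ (3 / 2 : ℝ) * K := hfloorR.trans hub
    have hsplit : R ^ (3 - q / 2 * (2 + ρ)) = R ^ (3 / 2 : ℝ) * R ^ e := by
      rw [he, ← Real.rpow_add hR0]; congr 1; ring
    rw [hsplit] at hcomb
    have hR32 : 0 < R ^ (3 / 2 : ℝ) := Real.rpow_pos_of_pos hR0 _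
    have : R ^ (3 / 2 : ℝ) * (ℓ * R ^ e) ≤ R ^ (3 / 2 : ℝ) * K := by
      calc R ^ (3 / 2 : ℝ) * (ℓ * R ^ e) = ℓ * (R ^ (3 / 2 : ℝ) * R ^ e) := by ring
        _ ≤ R ^ (3 / 2 : ℝ) * K := hcomb
    exact le_of_mul_le_mul_left this hR32
  -- (2) eventually `K < ℓ R^e`
  have h2 : ∀ᶠ R : ℝ in atTop, K < ℓ * R ^ e :=
    ((tendsto_rpow_atTop he0).const_mul_atTop hℓ).eventually_gt_atTop K
  obtain ⟨R, hle, hgt⟩ := (h1.and h2).exists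
  exact absurd hle (not_le.2 hgt)

/-- **The face «L^q vorticity» is empty in the budget class, given the floor** (`0 ≤ ρ`): for a budget-class `C²` profile,
`MomentFloorLaw ρ V → HasLqVorticity ρ V → curl V = 0`. -/
theorem curl_eq_zero_of_hasLqVorticity_of_momentFloorLaw {ρ : ℝ} (hρ : 0 ≤ ρ) {V : (EuclideanSpace ℝ (Fin 3)) → (EuclideanSpace ℝ (Fin 3))} {P : (EuclideanSpace ℝ (Fin 3)) → ℝ}
    (hfloor : MomentFloorLaw ρ V) (hprof : IsSelfSimilarEulerProfile (1 / (2 + ρ)) 0 V P)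
    (hE : (∫⁻ y, ‖fderiv ℝ V y‖ₑ ^ 2 * ENNReal.ofReal (‖y‖ ^ (ρ - 1))) ≠ ⊤)
    (hA : ∃ A : ℝ, ∀ R : ℝ, 1 ≤ R → ∫ y in Metric.ball (0 : (EuclideanSpace ℝ (Fin 3))) R, ‖V y‖ ^ 2 ≤ A * R ^ (1 - 2 * ρ))
    (hLq : HasLqVorticity ρ V) : ∀ y, curl V y = 0 := by
  obtain ⟨q, hq, hq3, hint⟩ := hLq
  exact lqVorticityExclusion_of_momentFloorLaw hρ hfloor P hprof hE hA q hq hq3 hint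

/-! ## §C  Proved glue: THE FLOOR + R52's SMALL-MOMENT LAW ⇒ POSITIVE-DENSITY BORDERLINE VORTICITY (Paley–Zygmund) -/

/-- **(F3) + `SmallMomentLaw` ⇒ (F4)** (`0 ≤ ρ`).  Floor at `q = ¼`: `∫_{B_R}‖Ω‖^{1/4} ≥ ℓR^{3−(2+ρ)/4}`; upper law at `2p = ½`:
`∫_{B_R}‖Ω‖^{1/2} ≤ C′R^{3−(2+ρ)/2}`.  With the threshold `t = λR^{−(2+ρ)}`, `λ^{1/4}·vol(B₁) = ℓ/2`, the sub-threshold part of the quarter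
moment is `≤ (ℓ/2)R^{3−(2+ρ)/4}`, so the super-threshold set `G_R` carries `≥ (ℓ/2)R^{3−(2+ρ)/4}`; Cauchy–Schwarz on `G_R` against the half
moment gives `(ℓ/2)R^{3−(2+ρ)/4} ≤ vol(G_R)^{1/2}(C′R^{3−(2+ρ)/2})^{1/2}`, i.e. `vol(G_R) ≥ (ℓ²/4C′)·R³`. [nsreg-p2 R53 §2] -/
theorem borderlineVorticityDensity_of_floor_of_smallMoment {ρ : ℝ} (_hρ : 0 ≤ ρ) {V : (EuclideanSpace ℝ (Fin 3)) → (EuclideanSpace ℝ (Fin 3))}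
    (hfloor : MomentFloorLaw ρ V) (hsm : SmallMomentLaw ρ V) : BorderlineVorticityDensity ρ V := by
  intro P hprof hE hA hne
  have hV2 : ContDiff ℝ 2 V := hprof.contDiff_velocity
  have hΩc : Continuous (curl V) := (contDiff_curl (n := 1) (by exact_mod_cast hV2)).continuous
  -- the floor at `1/4` and the upper law at `2p = 1/2`
  obtain ⟨ℓ, R₁, hℓ, hfl⟩ := hfloor P hprof hE hA hne (1 / 4) (by norm_num) (by norm_num)
  obtain ⟨C, hC⟩ := hsm P hprof (1 / 4) (by norm_num) (by norm_num) hE hA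
  set C' : ℝ := max C 1 with hC'
  have hC'0 : 0 < C' := lt_of_lt_of_le one_pos (le_max_right _ _)
  have hup : ∀ R : ℝ, 1 ≤ R → ∫ y in Metric.ball (0 : (EuclideanSpace ℝ (Fin 3))) R, ‖curl V y‖ ^ (1 / 2 : ℝ) ≤ C' * R ^ (3 - (2 + ρ) / 2) := by
    intro R hR
    have h := hC R hR
    have e1 : (2 : ℝ) * (1 / 4) = 1 / 2 := by norm_num
    have e2 : (3 : ℝ) - 1 / 2 * (2 + ρ) = 3 - (2 + ρ) / 2 := by ring
    rw [e1, e2] at h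
    exact h.trans (mul_le_mul_of_nonneg_right (le_max_left _ _) (Real.rpow_nonneg (by linarith) _))
  -- the unit-ball volume and the threshold constant
  set v₁ : ℝ := (volume (Metric.ball (0 : (EuclideanSpace ℝ (Fin 3))) 1)).toReal with hv₁
  have hv₁0 : 0 < v₁ := ENNReal.toReal_pos (measure_ball_pos volume (0 : (EuclideanSpace ℝ (Fin 3))) one_pos).ne' measure_ball_lt_top.ne
  set lam : ℝ := (ℓ / (2 * v₁)) ^ (4 : ℕ) with hlam
  have hlam0 : 0 < lam := by positivity
  have hlam4 : lam ^ (1 / 4 : ℝ) = ℓ / (2 * v₁) := by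
    rw [hlam, show (1 / 4 : ℝ) = ((4 : ℕ) : ℝ)⁻¹ by norm_num]
    exact Real.pow_rpow_inv_natCast (by positivity) (by norm_num)
  refine ⟨lam, ℓ ^ 2 / (4 * C'), max R₁ 1, hlam0, by positivity, fun R hR => ?_⟩
  have hR1 : 1 ≤ R := le_trans (le_max_right _ _) hR
  have hRR₁ : R₁ ≤ R := le_trans (le_max_left _ _) hR
  have hR0 : 0 < R := by linarith
  -- the threshold set
  set t : ℝ := lam * R ^ (-(2 + ρ)) with ht
  have ht0 : 0 < t := mul_pos hlam0 (Real.rpow_pos_of_pos hR0 _)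
  have ht4 : t ^ (1 / 4 : ℝ) = ℓ / (2 * v₁) * R ^ (-(2 + ρ) / 4) := by
    rw [ht, Real.mul_rpow hlam0.le (Real.rpow_nonneg hR0.le _), hlam4, ← Real.rpow_mul hR0.le]
    congr 1; ring
  set G' : Set (EuclideanSpace ℝ (Fin 3)) := {y : (EuclideanSpace ℝ (Fin 3)) | t ≤ ‖curl V y‖} with hG'
  have hG'm : MeasurableSet G' := (isClosed_le continuous_const hΩc.norm).measurableSet
  have hGdef : {y ∈ Metric.ball (0 : (EuclideanSpace ℝ (Fin 3))) R | lam * R ^ (-(2 + ρ)) ≤ ‖curl V y‖} = Metric.ball (0 : (EuclideanSpace ℝ (Fin 3))) R ∩ G' := rfl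
  rw [hGdef]
  -- integrability on the ball
  have hIq : ∀ q : ℝ, 0 < q → IntegrableOn (fun y => ‖curl V y‖ ^ q) (Metric.ball (0 : (EuclideanSpace ℝ (Fin 3))) R) := fun q hq0 =>
    ((hΩc.norm.rpow_const fun _ => Or.inr hq0.le).continuousOn.integrableOn_compact (isCompact_closedBall (0 : (EuclideanSpace ℝ (Fin 3))) R)).mono_set
      Metric.ball_subset_closedBall
  have hI14 := hIq (1 / 4) (by norm_num)
  have hI12 := hIq (1 / 2) (by norm_num)
  -- (1) the split of the quarter moment
  have hsplit := integral_inter_add_sdiff hG'm hI14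
  -- (2) the sub-threshold part
  have hsmall : ∫ y in Metric.ball (0 : (EuclideanSpace ℝ (Fin 3))) R \ G', ‖curl V y‖ ^ (1 / 4 : ℝ) ≤ ℓ / 2 * R ^ (3 - (2 + ρ) / 4) := by
    have hmono : ∫ y in Metric.ball (0 : (EuclideanSpace ℝ (Fin 3))) R \ G', ‖curl V y‖ ^ (1 / 4 : ℝ) ≤ ∫ y in Metric.ball (0 : (EuclideanSpace ℝ (Fin 3))) R \ G', t ^ (1 / 4 : ℝ) := by
      refine setIntegral_mono_on (hI14.mono_set Set.sdiff_subset) ?_ (measurableSet_ball.diff hG'm) fun y hy => ?_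
      · exact integrableOn_const (measure_ne_top_of_subset Set.sdiff_subset measure_ball_lt_top.ne)
      · have hlt : ‖curl V y‖ < t := not_le.1 hy.2
        exact Real.rpow_le_rpow (norm_nonneg _) hlt.le (by norm_num)
    have hconst : ∫ y in Metric.ball (0 : (EuclideanSpace ℝ (Fin 3))) R \ G', t ^ (1 / 4 : ℝ) =
        (volume (Metric.ball (0 : (EuclideanSpace ℝ (Fin 3))) R \ G')).toReal * t ^ (1 / 4 : ℝ) := by
      rw [setIntegral_const, smul_eq_mul, measureReal_def]
    have hvol : (volume (Metric.ball (0 : (EuclideanSpace ℝ (Fin 3))) R \ G')).toReal ≤ R ^ (3 : ℕ) * v₁ := by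
      rw [← volume_ball_toReal_eq R hR0.le]
      exact ENNReal.toReal_mono measure_ball_lt_top.ne (measure_mono Set.sdiff_subset)
    calc ∫ y in Metric.ball (0 : (EuclideanSpace ℝ (Fin 3))) R \ G', ‖curl V y‖ ^ (1 / 4 : ℝ)
        ≤ (volume (Metric.ball (0 : (EuclideanSpace ℝ (Fin 3))) R \ G')).toReal * t ^ (1 / 4 : ℝ) := hmono.trans hconst.le
      _ ≤ R ^ (3 : ℕ) * v₁ * t ^ (1 / 4 : ℝ) := mul_le_mul_of_nonneg_right hvol (Real.rpow_nonneg ht0.le _)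
      _ = ℓ / 2 * R ^ (3 - (2 + ρ) / 4) := by
          rw [ht4, ← Real.rpow_natCast, show (3 : ℝ) - (2 + ρ) / 4 = (3 : ℕ) + -(2 + ρ) / 4 by push_cast; ring,
            Real.rpow_add hR0]
          field_simp
  -- (3) the super-threshold part carries half the floor
  have hbig : ℓ / 2 * R ^ (3 - (2 + ρ) / 4) ≤ ∫ y in Metric.ball (0 : (EuclideanSpace ℝ (Fin 3))) R ∩ G', ‖curl V y‖ ^ (1 / 4 : ℝ) := by
    have hflR := hfl R hRR₁
    have e : (3 : ℝ) - 1 / 4 * (2 + ρ) = 3 - (2 + ρ) / 4 := by ring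
    rw [e] at hflR
    linarith
  -- (4) Cauchy–Schwarz on `B_R ∩ G'` against the half moment
  have hfin : volume (Metric.ball (0 : (EuclideanSpace ℝ (Fin 3))) R ∩ G') ≠ ⊤ := measure_ne_top_of_subset inter_subset_left measure_ball_lt_top.ne
  have hCS := setIntegral_rpow_half_le hΩc (q := 1 / 2) (by norm_num) hfin (hI12.mono_set inter_subset_left)
  have e14 : (1 / 2 : ℝ) / 2 = 1 / 4 := by norm_num
  rw [e14] at hCS
  have hhalf : ∫ y in Metric.ball (0 : (EuclideanSpace ℝ (Fin 3))) R ∩ G', ‖curl V y‖ ^ (1 / 2 : ℝ) ≤ C' * R ^ (3 - (2 + ρ) / 2) :=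
    (setIntegral_mono_set hI12 (ae_of_all _ fun y => Real.rpow_nonneg (norm_nonneg _) _)
      (ae_of_all _ inter_subset_left)).trans (hup R hR1)
  have hhalf0 : 0 ≤ ∫ y in Metric.ball (0 : (EuclideanSpace ℝ (Fin 3))) R ∩ G', ‖curl V y‖ ^ (1 / 2 : ℝ) :=
    integral_nonneg fun y => Real.rpow_nonneg (norm_nonneg _) _
  set m : ℝ := (volume (Metric.ball (0 : (EuclideanSpace ℝ (Fin 3))) R ∩ G')).toReal with hm
  have hm0 : 0 ≤ m := ENNReal.toReal_nonneg
  -- chain: (ℓ/2) R^{3−(2+ρ)/4} ≤ m^{1/2} (C' R^{3−(2+ρ)/2})^{1/2} = m^{1/2} C'^{1/2} R^{3/2 − (2+ρ)/4}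
  have hchain : ℓ / 2 * R ^ (3 - (2 + ρ) / 4) ≤ m ^ (1 / 2 : ℝ) * (C' * R ^ (3 - (2 + ρ) / 2)) ^ (1 / 2 : ℝ) :=
    hbig.trans (hCS.trans (mul_le_mul_of_nonneg_left (Real.rpow_le_rpow hhalf0 hhalf (by norm_num)) (Real.rpow_nonneg hm0 _)))
  have hrhs : m ^ (1 / 2 : ℝ) * (C' * R ^ (3 - (2 + ρ) / 2)) ^ (1 / 2 : ℝ) =
      m ^ (1 / 2 : ℝ) * C' ^ (1 / 2 : ℝ) * R ^ ((3 - (2 + ρ) / 2) / 2) := by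
    rw [Real.mul_rpow hC'0.le (Real.rpow_nonneg hR0.le _), ← Real.rpow_mul hR0.le]
    ring_nf
  have hlhs : ℓ / 2 * R ^ (3 - (2 + ρ) / 4) = ℓ / 2 * R ^ (3 / 2 : ℝ) * R ^ ((3 - (2 + ρ) / 2) / 2) := by
    rw [mul_assoc, ← Real.rpow_add hR0]
    congr 2; ring
  rw [hrhs, hlhs] at hchain
  have hRe : 0 < R ^ ((3 - (2 + ρ) / 2) / 2) := Real.rpow_pos_of_pos hR0 _
  have hkey : ℓ / 2 * R ^ (3 / 2 : ℝ) ≤ m ^ (1 / 2 : ℝ) * C' ^ (1 / 2 : ℝ) := le_of_mul_le_mul_right hchain hRe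
  -- square it: (ℓ²/4) R³ ≤ m C'
  have hsq : (ℓ / 2 * R ^ (3 / 2 : ℝ)) ^ 2 ≤ (m ^ (1 / 2 : ℝ) * C' ^ (1 / 2 : ℝ)) ^ 2 :=
    pow_le_pow_left₀ (by positivity) hkey 2
  have el : (ℓ / 2 * R ^ (3 / 2 : ℝ)) ^ 2 = ℓ ^ 2 / 4 * R ^ (3 : ℝ) := by
    have h3 : (R ^ (3 / 2 : ℝ)) ^ 2 = R ^ (3 : ℝ) := by
      rw [← Real.rpow_natCast, ← Real.rpow_mul hR0.le]; norm_num
    rw [mul_pow, h3]; ring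
  have er : (m ^ (1 / 2 : ℝ) * C' ^ (1 / 2 : ℝ)) ^ 2 = m * C' := by
    have h1 : (m ^ (1 / 2 : ℝ)) ^ 2 = m := by
      rw [← Real.rpow_natCast, ← Real.rpow_mul hm0]; norm_num
    have h2 : (C' ^ (1 / 2 : ℝ)) ^ 2 = C' := by
      rw [← Real.rpow_natCast, ← Real.rpow_mul hC'0.le]; norm_num
    rw [mul_pow, h1, h2]
  rw [el, er] at hsq
  -- conclude
  rw [div_mul_eq_mul_div, div_le_iff₀ (by positivity)]
  calc ℓ ^ 2 * R ^ (3 : ℝ) = 4 * (ℓ ^ 2 / 4 * R ^ (3 : ℝ)) := by ring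
    _ ≤ 4 * (m * C') := by linarith
    _ = m * (4 * C') := by ring

/-- THE FLOOR denies the face «sub-borderline vorticity in q-mean» (pure logic + `R^{3−q(2+ρ)} > 0`). -/
theorem curl_eq_zero_of_subBorderline_of_momentFloorLaw {ρ : ℝ} {V : (EuclideanSpace ℝ (Fin 3)) → (EuclideanSpace ℝ (Fin 3))} {P : (EuclideanSpace ℝ (Fin 3)) → ℝ}
    (hfloor : MomentFloorLaw ρ V) (hprof : IsSelfSimilarEulerProfile (1 / (2 + ρ)) 0 V P)
    (hE : (∫⁻ y, ‖fderiv ℝ V y‖ₑ ^ 2 * ENNReal.ofReal (‖y‖ ^ (ρ - 1))) ≠ ⊤)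
    (hA : ∃ A : ℝ, ∀ R : ℝ, 1 ≤ R → ∫ y in Metric.ball (0 : (EuclideanSpace ℝ (Fin 3))) R, ‖V y‖ ^ 2 ≤ A * R ^ (1 - 2 * ρ))
    (h : HasSubBorderlineVorticity ρ V) : ∀ y, curl V y = 0 := by
  by_contra hne
  push Not at hne
  obtain ⟨q, hq, hq1, hsub⟩ := h
  obtain ⟨ℓ, R₁, hℓ, hfl⟩ := hfloor P hprof hE hA hne q hq hq1
  obtain ⟨R, hR, hint⟩ := hsub (ℓ / 2) (by positivity) (max R₁ 1)
  have hflR := hfl R (le_trans (le_max_left _ _) hR)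
  have hR0 : 0 < R := lt_of_lt_of_le one_pos (le_trans (le_max_right _ _) hR)
  have hRa : 0 < R ^ (3 - q * (2 + ρ)) := Real.rpow_pos_of_pos hR0 _
  nlinarith

end Summit.NavierStokesRegularity.NavierStokesRegularity.Theorems.PowerGaugeEulerLiouville.MomentFloor

end
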